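import Summits.BirchSwinnertonDyer.Rank1Residual.X9.PrintCertSchema
import Summits.BirchSwinnertonDyer.Rank1Residual.X9.ChaDescentRecords
import Summits.BirchSwinnertonDyer.Rank1Residual.X11b.CertificateCheckBridge
import Literature.NumberTheory.EllipticCurves.Rank1Residual.X11RankOneCertificates.Instances
import HarnessLib

/-!
# Leaves X9 / X10b — per-pair certificate records: what a passing recheck DISCHARGES in the kernel
# (companion of `X9/PrintCertSchema.lean`; the CLAIMS are in `X9/PrintCertClaim.lean`)

HONEST FRAMING (cell `bsd-print-x9`, D-0131 (2) print tier; partition leaves `ClassX9` and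
`ClassX10 ∧ ¬Surj`): theorems and two plumbing definitions; no named fact; no leaf is claimed closed
(`BSDpOnClassX9`, `BSDpOnClassX10b` stay `@[conjecture]`). PER PAIR: for a record `r`, ANY globally minimal
elliptic `W/ℚ` with the record's integral model (`hI : integralModelInt W = r.intCurve`; for the display files
`W = r.curve`, `hI = r.integralModelInt_curve`) and a free prime `q` with `hq : q = r.p` (so literal `3`/`5`/`7`
fit), `r.check = true` gives IN THE KERNEL: GOOD ORDINARY reduction at `p` with `a_p(W) = r.ap`
(`goodOrd_of_check`, point count via `X11b.natCard_point_eq_countPoints`), `E[p]` IRREDUCIBLE (`irr_of_check`,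
Frobenius witness via `IntModel.hasIrreducibleModPGaloisRep_of_intModel_of_noroot`, Mazur 1978 Prop. 6.3 (1)),
NOT CM (`not_hasCM_of_check`, `j ∉` the 13 CM values, tree theorem `hasCM_iff_j_mem_holds`), NOT SEMISTABLE when
an additive prime is listed (`not_semistable_of_check`), NOT (ram) when `r.ram = false` (`not_ram_of_check`: `Δ`
is supported on the listed primes with exact valuations and types; additive primes are not multiplicative).
Hence the LEAF PREDICATES up to the two non-decidable CLAIMS `¬Surj`, `r_an = rank` (`PrintCertClaim.lean`):
`classX9_of_check` (`p ≥ 5`, verbatim `Rank1Residual.ClassX9 W p`) and `classX10_of_check` (`p = 3`,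
`ClassX10 W 3`, both ranks). Minimality of the record's own model (Kraus) is in `X9/PrintCertClaim.lean`.
References: [Mazur1978] Prop. 6.3 (1); [SilvermanAEC2009] III.1, VII.5.1, C §11; [IrelandRosen1990] §8.1; [Cremona2006].
-/

set_option autoImplicit false

noncomputable section

open scoped Classical MatrixGroups ModularForm

open CongruenceSubgroup WeierstrassCurve Literature.NumberTheory.EllipticCurves
  Literature.NumberTheory.EllipticCurves.ModularForms Literature.NumberTheory.EllipticCurves.Rank1Residual
  Literature.NumberTheory.EllipticCurves.Rank1Residual.X11RankOneCertificates
  Summit.BirchSwinnertonDyer.BirchSwinnertonDyer.Rank1Residual.IntModel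
  Summit.BirchSwinnertonDyer.BirchSwinnertonDyer.Rank1Residual.X11RankOne
  Summit.BirchSwinnertonDyer.Rank1Residual.X11b

namespace Summit.BirchSwinnertonDyer.Rank1Residual.X9.PrintCert

section Additive

open IsDedekindDomain NumberField Rat.HeightOneSpectrum

/-- An ADDITIVE prime is not multiplicative: for a globally minimal `W` with integral model `E₀`, `q ∣ Δ(E₀)`
and `q ∣ c₄(E₀)` give additive reduction at `q` (the tree's `hasAdditiveReductionAt_iff_of_isMinimalAt`, as in
`IntModel.not_semistable_of_intModel`), excluding multiplicative reduction. [cite: SilvermanAEC2009, VII.5 Prop. 5.1 (c)] -/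
theorem not_hasMultiplicativeReductionAtPrime_of_dvd_of_dvd {W : WeierstrassCurve ℚ} [W.IsElliptic]
    [W.IsGloballyMinimal] {E₀ : WeierstrassCurve ℤ} (hI : integralModelInt W = E₀) (q : ℕ)
    [hq : Fact q.Prime] (hΔ : (q : ℤ) ∣ E₀.Δ) (hc₄ : (q : ℤ) ∣ E₀.c₄) :
    ¬ W.HasMultiplicativeReductionAtPrime q := by
  intro hm
  set v : HeightOneSpectrum (𝓞 ℚ) := (primesEquiv (R := 𝓞 ℚ)).symm ⟨q, hq.out⟩ with hvdef
  have hv : primesEquiv v = ⟨q, hq.out⟩ := Equiv.apply_symm_apply _ _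
  haveI : Fact (primesEquiv v : ℕ).Prime := ⟨(primesEquiv v).2⟩
  have hadd : W.HasAdditiveReductionAt v := by
    rw [hasAdditiveReductionAt_iff_of_isMinimalAt (IsGloballyMinimal.isMinimal (W := W) v),
      Δ_eq_cast hI, c₄_eq_cast hI, (valuation_equiv_padicValuation v).lt_one_iff_lt_one,
      (valuation_equiv_padicValuation v).lt_one_iff_lt_one, Rat.padicValuation_cast,
      Rat.padicValuation_cast, Int.padicValuation_lt_one_iff, Int.padicValuation_lt_one_iff, hv]
    exact ⟨hΔ, hc₄⟩
  have key : ∀ q' : Nat.Primes, primesEquiv v = q' →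
      (haveI := Fact.mk q'.2; W.HasMultiplicativeReductionAtPrime (q' : ℕ)) →
      W.HasMultiplicativeReductionAt v := by
    rintro q' rfl h
    exact (hasMultiplicativeReductionAtPrime_iff_hasMultiplicativeReductionAt_ringOfIntegers W v).mp h
  exact hadd.not_hasMultiplicativeReductionAt (key ⟨q, hq.out⟩ hv hm)

end Additive

namespace Record

variable (r : Record)

/-- The integer Weierstrass equation with the record's a-invariants (junk unless five entries). [folklore] -/
def intCurve : WeierstrassCurve ℤ :=
  match r.ainvs with
  | [a₁, a₂, a₃, a₄, a₆] => ⟨a₁, a₂, a₃, a₄, a₆⟩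
  | _ => ⟨0, 0, 0, 0, 0⟩

/-- The record's curve over `ℚ`: the base change of `intCurve` (Cremona's reduced minimal model). [folklore] -/
def curve : WeierstrassCurve ℚ := r.intCurve.map (Int.castRingHom ℚ)

variable {r} in
/-- `intCurve` on five literal a-invariants. [folklore] -/
theorem intCurve_eq {a1 a2 a3 a4 a6 : ℤ} (h : r.ainvs = [a1, a2, a3, a4, a6]) :
    r.intCurve = ⟨a1, a2, a3, a4, a6⟩ := by
  simp only [intCurve, h]

variable {r} in
/-- `curve` on five literal a-invariants. [folklore] -/
theorem curve_eq {a1 a2 a3 a4 a6 : ℤ} (h : r.ainvs = [a1, a2, a3, a4, a6]) :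
    r.curve = ⟨a1, a2, a3, a4, a6⟩ := by
  rw [curve, intCurve_eq h, map_mk_int]

/-- The tree's integral model of the record's curve (granted global minimality) IS `intCurve`. [folklore] -/
theorem integralModelInt_curve [r.curve.IsGloballyMinimal] : integralModelInt r.curve = r.intCurve :=
  integralModelInt_eq_of_map_eq _ rfl

/-- A passing recheck found five a-invariants with non-zero recomputed discriminant. [folklore] -/
theorem ainvs_spec_of_check (hc : r.check = true) :
    ∃ a1 a2 a3 a4 a6 : ℤ, r.ainvs = [a1, a2, a3, a4, a6] ∧ discOf [a1, a2, a3, a4, a6] ≠ 0 := by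
  have hs := r.passSupport_of_check hc
  simp only [passSupport, Bool.and_eq_true, beq_iff_eq, decide_eq_true_eq] at hs
  obtain ⟨⟨⟨⟨⟨⟨⟨hlen, -⟩, -⟩, -⟩, -⟩, hne⟩, -⟩, -⟩ := hs
  rcases hA : r.ainvs with _ | ⟨a1, _ | ⟨a2, _ | ⟨a3, _ | ⟨a4, _ | ⟨a6, _ | ⟨x, t⟩⟩⟩⟩⟩⟩ <;>
    simp [hA] at hlen
  exact ⟨a1, a2, a3, a4, a6, rfl, hA ▸ hne⟩

/-- `Δ(intCurve)` is the schema's recomputed `discOf ainvs`. [cite: SilvermanAEC2009, III.1 (p. 42)] -/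
theorem intCurve_Δ_eq (hc : r.check = true) : r.intCurve.Δ = discOf r.ainvs := by
  obtain ⟨a1, a2, a3, a4, a6, hA, -⟩ := r.ainvs_spec_of_check hc
  rw [intCurve_eq hA, hA]
  exact intCurve_Δ a1 a2 a3 a4 a6

/-- `c₄(intCurve)` is the schema's recomputed `c4Of ainvs`. [cite: SilvermanAEC2009, III.1 (p. 42)] -/
theorem intCurve_c₄_eq (hc : r.check = true) : r.intCurve.c₄ = c4Of r.ainvs := by
  obtain ⟨a1, a2, a3, a4, a6, hA, -⟩ := r.ainvs_spec_of_check hc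
  rw [intCurve_eq hA, hA]
  exact intCurve_c₄ a1 a2 a3 a4 a6

/-- The two instances a consumer of a passing record needs: `r.p` is prime (`p ∈ {3, 5, 7}`) and the
record's curve is elliptic (`Δ(ainvs) ≠ 0` was rechecked). [folklore] -/
theorem instances_of_check (hc : r.check = true) : Fact r.p.Prime ∧ r.curve.IsElliptic := by
  obtain ⟨a1, a2, a3, a4, a6, hA, hne⟩ := r.ainvs_spec_of_check hc
  refine ⟨⟨?_⟩, ?_⟩
  · rcases r.p_mem_of_check hc with h | h | h <;> rw [h] <;> norm_num
  · rw [curve_eq hA]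
    exact isElliptic_of_discOf_ne_zero a1 a2 a3 a4 a6 hne

/-! ### Kernel discharges for any globally minimal `W` with the record's integral model (free prime
`q`, `hq : q = r.p`, so that literal `3`, `5`, `7` and their global `Fact` instances fit without rewriting) -/

section Discharge

variable {W : WeierstrassCurve ℚ} [W.IsElliptic] [W.IsGloballyMinimal] (hI : integralModelInt W = r.intCurve)
include hI

omit [W.IsElliptic] in
/-- GOOD reduction at `p`: `p ∤ Δ_min` (rechecked as `discOf ainvs % p ≠ 0`). [cite: SilvermanAEC2009, Prop. VII.5.1 (a)] -/
theorem good_of_check (hc : r.check = true) {q : ℕ} [Fact q.Prime] (hq : q = r.p) :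
    W.HasGoodReductionAtPrime q := by
  subst hq
  have h' := r.passReduction_of_check hc
  simp only [passReduction, Bool.and_eq_true, decide_eq_true_eq] at h'
  obtain ⟨⟨⟨⟨⟨-, -⟩, hΔ⟩, -⟩, -⟩, -⟩ := h'
  refine hasGoodReductionAtPrime_of_not_dvd W r.p ?_
  rw [minimalDiscriminantInt_eq hI, r.intCurve_Δ_eq hc]
  exact fun h => hΔ (Int.emod_eq_zero_of_dvd h)

omit [W.IsElliptic] [W.IsGloballyMinimal] hI in
/-- The point count of the reduction at `p` is the record's `nP = p + 1 − a_p` (schema count =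
kernel count, `X11b.natCard_point_eq_countPoints`). [cite: IrelandRosen1990, Prop. 5.1.2 and §8.1] -/
theorem natCard_eq_of_check (hc : r.check = true) {q : ℕ} [Fact q.Prime] (hq : q = r.p) :
    Nat.card ((r.intCurve.map (Int.castRingHom (ZMod q))).toAffine.Point) = r.nP := by
  subst hq
  obtain ⟨a1, a2, a3, a4, a6, hA, -⟩ := r.ainvs_spec_of_check hc
  have h' := r.passReduction_of_check hc
  simp only [passReduction, Bool.and_eq_true, decide_eq_true_eq, beq_iff_eq] at h'
  obtain ⟨⟨⟨⟨⟨-, -⟩, hΔ⟩, hap⟩, hnP⟩, -⟩ := h'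
  have hp2 : r.p ≠ 2 := by rcases r.p_mem_of_check hc with h | h | h <;> omega
  have hΔ' : ¬ (r.p : ℤ) ∣ (⟨a1, a2, a3, a4, a6⟩ : WeierstrassCurve ℤ).Δ := by
    rw [intCurve_Δ, ← hA]; exact fun h => hΔ (Int.emod_eq_zero_of_dvd h)
  have key := natCard_point_eq_countPoints a1 a2 a3 a4 a6 r.p hp2 hΔ'
  rw [intCurve_eq hA]
  have hcount : countPoints [a1, a2, a3, a4, a6] r.p = (r.nP : ℤ) := by
    rw [hA] at hap
    simp only [apNaive] at hap
    linarith
  rw [hcount] at key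
  exact_mod_cast key

omit [W.IsElliptic] in
/-- `a_p(W) = r.ap`. [folklore] -/
theorem frobeniusTrace_eq_of_check (hc : r.check = true) {q : ℕ} [Fact q.Prime] (hq : q = r.p) :
    W.frobeniusTrace q = r.ap := by
  rw [frobeniusTrace_eq hI (r.natCard_eq_of_check hc hq)]
  subst hq
  have h' := r.passReduction_of_check hc
  simp only [passReduction, Bool.and_eq_true, decide_eq_true_eq, beq_iff_eq] at h'
  obtain ⟨⟨⟨⟨⟨-, -⟩, -⟩, -⟩, hnP⟩, -⟩ := h'
  linarith

omit [W.IsElliptic] in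
/-- GOOD ORDINARY reduction at `p` (`p ∤ a_p`, rechecked as `ap % p ≠ 0`). [cite: SilvermanAEC2009, Prop. VII.5.1 (a)] -/
theorem goodOrd_of_check (hc : r.check = true) {q : ℕ} [Fact q.Prime] (hq : q = r.p) : GoodOrd W q := by
  refine ⟨r.good_of_check hI hc hq, ?_⟩
  rw [r.frobeniusTrace_eq_of_check hI hc hq]
  subst hq
  have h' := r.passReduction_of_check hc
  simp only [passReduction, Bool.and_eq_true, decide_eq_true_eq, beq_iff_eq] at h'
  exact fun h => h'.2 (Int.emod_eq_zero_of_dvd h)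

omit [W.IsElliptic] in
/-- `p` is ANOMALOUS for `W` (`a_p ≡ 1 (mod p)`) iff the record says so. [folklore] -/
theorem anomalous_iff_of_check (hc : r.check = true) {q : ℕ} [Fact q.Prime] (hq : q = r.p) :
    (q : ℤ) ∣ W.frobeniusTrace q - 1 ↔ r.anomalous = true := by
  rw [r.frobeniusTrace_eq_of_check hI hc hq, hq, anomalous, decide_eq_true_eq]
  exact ⟨Int.emod_eq_zero_of_dvd, Int.dvd_of_emod_eq_zero⟩

/-- `E[p]` is IRREDUCIBLE: the rechecked Frobenius witness `(ℓ, a_ℓ)` — `ℓ ∤ pΔ` odd, `#Ẽ(𝔽_ℓ)` by the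
schema count, `X² − a_ℓX + ℓ` root-free mod `p` — fed to Mazur's criterion as the tree's `IntModel`
toolkit states it. [cite: Mazur1978, §6 Prop. 6.3 (1) (p. 153)] -/
theorem irr_of_check (hc : r.check = true) {q : ℕ} [Fact q.Prime] (hq : q = r.p) : Irr W q := by
  subst hq
  obtain ⟨a1, a2, a3, a4, a6, hA, -⟩ := r.ainvs_spec_of_check hc
  have h' := r.passIrr_of_check hc
  simp only [passIrr, Bool.and_eq_true, decide_eq_true_eq, beq_iff_eq, List.all_eq_true,
    List.mem_range] at h'
  obtain ⟨⟨⟨⟨⟨⟨⟨⟨⟨⟨h3, -⟩, hprime⟩, hℓp⟩, -⟩, hℓΔ⟩, haℓ⟩, hnoroot⟩, -⟩, -⟩, -⟩ := h'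
  haveI : Fact r.irrWitness.1.Prime := ⟨prime_of_isPrimeBelow504100 hprime⟩
  haveI : NeZero r.p := ⟨(Fact.out : r.p.Prime).ne_zero⟩
  have hℓ2 : r.irrWitness.1 ≠ 2 := by omega
  have hW : integralModelInt W = ⟨a1, a2, a3, a4, a6⟩ := by rw [hI, intCurve_eq hA]
  have hΔℓ : ¬ (r.irrWitness.1 : ℤ) ∣ (⟨a1, a2, a3, a4, a6⟩ : WeierstrassCurve ℤ).Δ := by
    rw [intCurve_Δ, ← hA]; exact fun h => hℓΔ (Int.emod_eq_zero_of_dvd h)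
  have hcardZ := natCard_point_eq_countPoints a1 a2 a3 a4 a6 r.irrWitness.1 hℓ2 hΔℓ
  have hn : (r.irrWitness.1 : ℤ) + 1 -
      (Nat.card (((⟨a1, a2, a3, a4, a6⟩ : WeierstrassCurve ℤ).map
        (Int.castRingHom (ZMod r.irrWitness.1))).toAffine.Point) : ℕ) = r.irrWitness.2 := by
    rw [hA] at haℓ
    simp only [apNaive] at haℓ
    linarith
  refine hasIrreducibleModPGaloisRep_of_intModel_of_noroot hW r.p r.irrWitness.1 hℓp hΔℓ rfl
    (forall_zmod_of_forall_lt fun t ht h0 ↦ hnoroot t ht ?_)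
  rw [hn] at h0
  apply Int.emod_eq_zero_of_dvd
  rw [← ZMod.intCast_zmod_eq_zero_iff_dvd]
  push_cast at h0 ⊢
  linear_combination h0

/-- NOT CM: `j(W) = c₄³/Δ` is none of the thirteen CM `j`-invariants (rechecked as `c₄³ ≠ j_CM·Δ`),
and `HasCM ↔ j ∈ cmJInvariants` is the tree THEOREM `hasCM_iff_j_mem_holds`. [cite: SilvermanAEC2009, App. C §11, Examples 11.3.1–11.3.2] -/
theorem not_hasCM_of_check (hc : r.check = true) : ¬ W.HasCM := by
  obtain ⟨a1, a2, a3, a4, a6, hA, -⟩ := r.ainvs_spec_of_check hc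
  have hW : integralModelInt W = ⟨a1, a2, a3, a4, a6⟩ := by rw [hI, intCurve_eq hA]
  have hcm := r.passNonCM_of_check hc
  simp only [passNonCM, List.all_eq_true, decide_eq_true_eq] at hcm
  have hs := r.passSupport_of_check hc
  simp only [passSupport, Bool.and_eq_true, decide_eq_true_eq] at hs
  obtain ⟨⟨⟨-, hne⟩, -⟩, -⟩ := hs
  rw [hA] at hcm hne
  intro hCM
  have hj := (hasCM_iff_j_mem_holds W).mp hCM
  rw [j_eq_of_intModel a1 a2 a3 a4 a6 hW] at hj
  have hΔq : ((discOf [a1, a2, a3, a4, a6] : ℤ) : ℚ) ≠ 0 := by exact_mod_cast hne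
  simp only [cmJInvariants, Finset.mem_insert, Finset.mem_singleton, div_eq_iff hΔq] at hj
  rcases hj with h | h | h | h | h | h | h | h | h | h | h | h | h
  · exact hcm (0) (by simp [cmJList]) (by exact_mod_cast h)
  · exact hcm (1728) (by simp [cmJList]) (by exact_mod_cast h)
  · exact hcm (-3375) (by simp [cmJList]) (by exact_mod_cast h)
  · exact hcm (8000) (by simp [cmJList]) (by exact_mod_cast h)
  · exact hcm (-32768) (by simp [cmJList]) (by exact_mod_cast h)
  · exact hcm (54000) (by simp [cmJList]) (by exact_mod_cast h)
  · exact hcm (287496) (by simp [cmJList]) (by exact_mod_cast h)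
  · exact hcm (-884736) (by simp [cmJList]) (by exact_mod_cast h)
  · exact hcm (-12288000) (by simp [cmJList]) (by exact_mod_cast h)
  · exact hcm (16581375) (by simp [cmJList]) (by exact_mod_cast h)
  · exact hcm (-884736000) (by simp [cmJList]) (by exact_mod_cast h)
  · exact hcm (-147197952000) (by simp [cmJList]) (by exact_mod_cast h)
  · exact hcm (-262537412640768000) (by simp [cmJList]) (by exact_mod_cast h)

/-- NOT SEMISTABLE when the record lists an additive prime (`f_q ≥ 2`, rechecked with `q ∣ Δ`, `q ∣ c₄`
on the minimal model). [cite: SilvermanAEC2009, Prop. VII.5.1 (c)] -/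
theorem not_semistable_of_check (hc : r.check = true) (hns : r.semistable = false) : ¬ Semistable W := by
  have hs := r.passSupport_of_check hc
  simp only [passSupport, Bool.and_eq_true, List.all_eq_true] at hs
  obtain ⟨⟨⟨⟨⟨⟨⟨-, hall⟩, -⟩, -⟩, -⟩, -⟩, -⟩, -⟩ := hs
  simp only [semistable, List.all_eq_false] at hns
  obtain ⟨t, ht, hft⟩ := hns
  have h := hall t ht
  simp only [decide_eq_true_eq] at h
  obtain ⟨⟨⟨⟨⟨⟨⟨⟨hprime, -⟩, hv⟩, -⟩, -⟩, hdvd⟩, -⟩, hc4⟩, -⟩ := h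
  have hq : t.1.Prime := prime_of_isPrimeBelow504100 hprime
  have hf1 : (t.2.1 == 1) = false := by simpa using hft
  rw [hf1] at hc4
  have hc4' : c4Of r.ainvs % (t.1 : ℤ) = 0 := by
    by_contra hne
    rw [decide_eq_true hne] at hc4
    exact Bool.false_ne_true hc4
  have hΔdvd : (t.1 : ℤ) ∣ r.intCurve.Δ := by
    rw [r.intCurve_Δ_eq hc]
    have hv0 : 0 < t.2.2.1 := by simpa using hv
    have h1 : (t.1 : ℤ) ∣ (t.1 : ℤ) ^ t.2.2.1 := dvd_pow_self _ (by omega)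
    exact h1.trans (Int.dvd_of_emod_eq_zero hdvd)
  have hc4dvd : (t.1 : ℤ) ∣ r.intCurve.c₄ := by
    rw [r.intCurve_c₄_eq hc]; exact Int.dvd_of_emod_eq_zero hc4'
  exact not_semistable_of_intModel hI t.1 hq hΔdvd hc4dvd

/-- **The leaf predicate X9 from a passing record** (`p ≥ 5`): `¬CM ∧ GoodOrd ∧ 5 ≤ p ∧ Irr` from the
recheck; `¬Surj` (`hns`) and the analytic rank (`hrank`) are the record's CLAIMS; the rank-one clause
`r_an = 1 → ¬semistable` from the rechecked leaf clause. [folklore] -/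
theorem classX9_of_check (hc : r.check = true) {q : ℕ} [Fact q.Prime] (hq : q = r.p) (hp5 : 5 ≤ q)
    (hns : ¬ Surj W q) (hrank : W.analyticRank = r.rank) : ClassX9 W q := by
  refine ⟨r.not_hasCM_of_check hI hc, r.goodOrd_of_check hI hc hq, hp5, r.irr_of_check hI hc hq, hns,
    fun h1 => ?_⟩
  subst hq
  have hinv := r.passInvariants_of_check hc
  simp only [passInvariants, Bool.and_eq_true] at hinv
  obtain ⟨-, hleaf⟩ := hinv
  have hp3 : (r.p == 3) = false := by simp; omega
  rw [hp3] at hleaf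
  simp only [Bool.false_eq_true, ↓reduceIte, Bool.and_eq_true, Bool.or_eq_true, beq_iff_eq,
    Bool.not_eq_true', decide_eq_true_eq] at hleaf
  rcases hleaf.2 with h0 | hsst
  · omega
  · exact r.not_semistable_of_check hI hc hsst

omit [W.IsElliptic] [W.IsGloballyMinimal] hI in
/-- A prime dividing the recomputed discriminant is a LISTED bad prime (`|Δ| = ∏ q^{v_q(Δ)}` over `bad` was
rechecked). [folklore] -/
theorem exists_mem_bad_of_prime_dvd (hc : r.check = true) {ℓ : ℕ} (hℓ : ℓ.Prime)
    (hℓΔ : (ℓ : ℤ) ∣ discOf r.ainvs) : ∃ t ∈ r.bad, t.1 = ℓ := by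
  have hs := r.passSupport_of_check hc
  simp only [passSupport, Bool.and_eq_true, List.all_eq_true, beq_iff_eq] at hs
  obtain ⟨⟨⟨⟨⟨⟨⟨-, hall⟩, -⟩, -⟩, hprod⟩, -⟩, -⟩, -⟩ := hs
  have h1 : ℓ ∣ (r.bad.map fun t => t.1 ^ t.2.2.1).prod := by
    rw [hprod]; exact Int.ofNat_dvd_left.mp hℓΔ
  obtain ⟨x, hx, hℓx⟩ := (Prime.dvd_prod_iff hℓ.prime).mp h1
  obtain ⟨t, ht, rfl⟩ := List.mem_map.mp hx
  have h := hall t ht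
  simp only [decide_eq_true_eq] at h
  obtain ⟨⟨⟨⟨⟨⟨⟨⟨hprime, -⟩, -⟩, -⟩, -⟩, -⟩, -⟩, -⟩, -⟩ := h
  exact ⟨t, ht, ((Nat.prime_dvd_prime_iff_eq hℓ (prime_of_isPrimeBelow504100 hprime)).mp
    (hℓ.dvd_of_dvd_pow hℓx)).symm⟩

/-- NOT (ram) at `p`: no multiplicative prime `ℓ ≠ p` has `p ∤ v_ℓ(Δ_min)` — unlisted primes have
`v_ℓ(Δ_min) = 0`; a listed `ℓ` has the rechecked exact valuation `v_ℓ(Δ)`, and is either multiplicative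
with `p ∣ v_ℓ(Δ)` (`r.ram = false`) or additive (`ℓ ∣ c₄`, `ℓ ∣ Δ` on the minimal model), hence not
multiplicative. [cite: SkinnerUrban2014, Thm. 2 (p. 3), second bullet] [cite: SilvermanAEC2009, Prop. VII.5.1 (b), (c)] -/
theorem not_ram_of_check (hc : r.check = true) (hram : r.ram = false) {q : ℕ} [Fact q.Prime]
    (hq : q = r.p) : ¬ Ram W q := by
  subst hq
  rintro ⟨ℓ, hℓF, hℓp, hmult, hpv⟩
  have hℓ : ℓ.Prime := hℓF.out
  rw [minimalDiscriminantInt_eq hI, r.intCurve_Δ_eq hc] at hpv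
  by_cases hℓΔ : (ℓ : ℤ) ∣ discOf r.ainvs
  · obtain ⟨t, ht, htℓ⟩ := r.exists_mem_bad_of_prime_dvd hc hℓ hℓΔ
    have hs := r.passSupport_of_check hc
    simp only [passSupport, Bool.and_eq_true, List.all_eq_true] at hs
    obtain ⟨⟨⟨⟨⟨⟨⟨-, hall⟩, -⟩, -⟩, -⟩, -⟩, -⟩, -⟩ := hs
    have h := hall t ht
    simp only [decide_eq_true_eq] at h
    obtain ⟨⟨⟨⟨⟨⟨⟨⟨-, -⟩, -⟩, -⟩, -⟩, hdvd⟩, hndvd⟩, hc4⟩, -⟩ := h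
    rw [htℓ] at hdvd hndvd hc4
    rw [padicValInt_eq_of_dvd_of_not_dvd ℓ (Int.dvd_of_emod_eq_zero hdvd)
      fun h ↦ hndvd (Int.emod_eq_zero_of_dvd h)] at hpv
    by_cases hf : (t.2.1 == 1) = true
    · -- a listed multiplicative prime: `r.ram = false` says `p ∣ v_ℓ(Δ)`
      refine hpv (Nat.dvd_of_mod_eq_zero ?_)
      by_contra hne
      refine List.any_eq_false.mp hram t ht ?_
      simp only [Bool.and_eq_true, decide_eq_true_eq, htℓ]
      exact ⟨⟨hℓp, hf⟩, hne⟩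
    · -- a listed additive prime is not multiplicative
      have hf' : (t.2.1 == 1) = false := by simpa using hf
      rw [hf'] at hc4
      have hc4' : c4Of r.ainvs % (ℓ : ℤ) = 0 := by
        by_contra hne
        rw [decide_eq_true hne] at hc4
        exact Bool.false_ne_true hc4
      have hΔdvd : (ℓ : ℤ) ∣ r.intCurve.Δ := by rw [r.intCurve_Δ_eq hc]; exact hℓΔ
      have hc4dvd : (ℓ : ℤ) ∣ r.intCurve.c₄ := by
        rw [r.intCurve_c₄_eq hc]; exact Int.dvd_of_emod_eq_zero hc4'
      exact not_hasMultiplicativeReductionAtPrime_of_dvd_of_dvd hI ℓ hΔdvd hc4dvd hmult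
  · rw [padicValInt.eq_zero_of_not_dvd hℓΔ] at hpv
    exact hpv (dvd_zero _)

/-- **The leaf predicate X10 from a passing record at `p = 3`** (the X10b slice is `ClassX10 ∧ ¬Surj W 3`,
`¬Surj` being the record's CLAIM): `GoodOrd ∧ Irr` from the recheck; by the rechecked leaf clause either
`rank = 0 ∧ ¬ram(3)` (`not_ram_of_check`) or `rank = 1 ∧ ¬semistable` (`not_semistable_of_check`); the
analytic rank `hrank` is the record's CLAIM. [folklore] -/
theorem classX10_of_check (hc : r.check = true) (hp3 : r.p = 3) {q : ℕ} [Fact q.Prime] (hq : q = r.p)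
    (hrank : W.analyticRank = r.rank) : ClassX10 W q := by
  have hq3 : q = 3 := hq.trans hp3
  have hinv := r.passInvariants_of_check hc
  simp only [passInvariants, Bool.and_eq_true] at hinv
  obtain ⟨-, hleaf⟩ := hinv
  have hp3' : (r.p == 3) = true := by simp [hp3]
  rw [hp3'] at hleaf
  simp only [↓reduceIte, Bool.or_eq_true, Bool.and_eq_true, beq_iff_eq, Bool.not_eq_true'] at hleaf
  refine ⟨hq3, r.goodOrd_of_check hI hc (q := 3) hp3.symm, r.irr_of_check hI hc (q := 3) hp3.symm, ?_⟩
  rcases hleaf with ⟨h0, hram⟩ | ⟨h1, hsst⟩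
  · exact Or.inl ⟨by rw [hrank, h0], r.not_ram_of_check hI hc hram (q := 3) hp3.symm⟩
  · exact Or.inr ⟨by rw [hrank, h1], r.not_semistable_of_check hI hc hsst⟩

end Discharge

end Record

end Summit.BirchSwinnertonDyer.Rank1Residual.X9.PrintCert

end
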